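import Mathlib
import Literature.Analysis.FluidPDE.ClassicalLocalEnergyCutoff
import Literature.Analysis.FluidPDE.WholeSpaceIBP
import Literature.Analysis.FluidPDE.NormalisedPressureL2Bound
import Literature.Analysis.Calculus.SphereIntegralCalculus
import HarnessLib

/-!
# Collapse-time energy of CLASSICAL members of the crux `EulerZoomLiouville.PowerGaugeEulerLiouville`:
# a nontrivial classical member with small far-field flux RETAINS energy on every large ball at the collapse
# time (route №10, item stmt-NavierStokesRegularity-19832; `--supports`)

Helper file (theorems only). Seat ns-typeII-p3 (cell ns-regularity-ideate §B, D-0081).  Crux E: an ancient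
local-energy Euler flow on `ℝ³ × (−∞,0)` in Seregin's power-gauged class vanishes; OPEN on `0 < ρ ≤ 1/2`
(lead's line `birth`, open stubs `stub_selfSimilarExtremal` / `stub_nonSelfSimilar ⊇ DSS`).  This file looks
at the OTHER end of the time axis from the lineage's backward-vanishing / quiescent-past strata: the COLLAPSE
TIME `τ → 0⁻`.  For a CLASSICAL member the energy identity against the tree's cut-offs `χ_R = cutoff R`
(`= 1` on `B_R`, `= 0` off `B_{2R}`, `‖Dχ_R‖ ≤ C/R`) is exact (no anomalous dissipation), so if the Euler flux
through the shells `R ≤ |y| ≤ 2R` is small at large `R` — the SHELL HYPOTHESIS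
`∫_{R≤|y|≤2R}(|u(τ)|³ + 2|p(τ)||u(τ)|) ≤ K R^β` for `R ≥ R₀(−τ)^γ`, some `β < 1` (the natural scale-invariant
tails `|u| ≲ |y|^{−1−ρ}`, `|p| ≲ |y|^{−2−2ρ}` on `|y| ≳ (−τ)^{1/(2+ρ)}` give `β = −3ρ`, `γ = 1/(2+ρ)`) — then the
cut-off energies `e_R(τ) = ∫ χ_R |u(τ)|²` FREEZE near the collapse:

* `cutoffEnergy_sub_eq` — the cut-off energy identity for classical Euler on `(−∞,0)` (tree
  `IsClassicalNSSolutionOn.local_energy_identity_cutoff` at `ν = 0`);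
* `abs_flux_le_shell`, `abs_cutoffEnergy_sub_le`, `abs_cutoffEnergy_sub_le_of_shell` —
  `|e_R(τ₂) − e_R(τ₁)| ≤ (C/R)·K R^β·(τ₂ − τ₁)` for `R ≥ R₀(−τ₁)^γ`, `τ₁ ≤ τ₂ < 0`;
* `exists_tendsto_cutoffEnergy` — **the COLLAPSE-TIME ENERGY PROFILE exists**: `e_R(τ) → L(R)` as `τ → 0⁻`,
  with `|e_R(τ) − L(R)| ≤ (C/R) K R^β (−τ)` (`L(R)` is Shvydkoy's energy measure `𝓔₀` at the blow-up time,
  Nonlinearity 26 (2013), tested against `χ_R`; Bronzi–Shvydkoy 2015 Rem. 1.2);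
* `eq_zero_of_collapseEnergy_vanishing` — **TRIVIALITY CRITERION**: if along arbitrarily large `R` the
  cut-off energy `e_R(τ)` comes arbitrarily close to `0` arbitrarily close to the collapse time
  (`liminf_{τ→0⁻} e_R(τ) = 0`), then `u ≡ 0` on the slab.  Contrapositive (the portrait of a nontrivial
  classical member, e.g. the in-window self-similar / DSS candidates): **its collapse RETAINS energy on every
  large ball**, `L(R) > 0` for all large `R` — with no energy concentration AT the origin (the `A`-gauge gives
  `L(R) ≤ c R^{1−2ρ} → 0` as `R → 0`), the energy sits at `|y| ≳ 1` as `τ → 0⁻`.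

The sequel `…DSSEnergySaturation` turns the criterion into the Bronzi–Shvydkoy ENERGY-SATURATION dichotomy for
classical λ-DSS members.  WHAT THIS IS NOT: not NS, not the crux E — classical members only; in the WEAK class
the backward direction of the identity fails (anomalous dissipation between `τ₁` and `0` is exactly the
Scheffer/NSI-type obstruction), which is why nothing here touches weak members.  [folklore; cf. BronziShvydkoy2015
Rem. 1.2]
-/
noncomputable section

-- the summit and its single problem share the name `NavierStokesRegularity` (D-0017 nested layout)
set_option linter.dupNamespace false

open Set Function Filter Topology MeasureTheory Metric
open scoped NNReal ENNReal InnerProductSpace RealInnerProductSpace Interval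

namespace Summit.NavierStokesRegularity.NavierStokesRegularity.Theorems.PowerGaugeEulerLiouville.CollapseEnergy

open Literature.Analysis Literature.Analysis.FluidPDE

variable {u : ℝ → EuclideanSpace ℝ (Fin 3) → EuclideanSpace ℝ (Fin 3)} {p : ℝ → EuclideanSpace ℝ (Fin 3) → ℝ}

/-! ## The cut-off energy identity on the open slab (`ν = 0`) -/

/-- **Cut-off energy identity for classical Euler on `(−∞, 0)`.** For `(u, p)` classical on the open slab
(`ν = 0`, `f = 0`), every `R` and `t₀ ≤ t₁ < 0`:
`∫ χ_R |u(t₁)|² − ∫ χ_R |u(t₀)|² = ∫_{t₀}^{t₁} ∫ (Dχ_R(u)|u|² + 2 p Dχ_R(u))`, `χ_R = cutoff R`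
(the tree's local energy identity against a time-independent cut-off, with the dissipative terms absent).
[folklore] -/
theorem cutoffEnergy_sub_eq (hns : IsClassicalNSSolutionOn (Iio 0) 0 0 u p) {R : ℝ} (hR : 0 < R)
    {t₀ t₁ : ℝ} (h01 : t₀ ≤ t₁) (ht₁ : t₁ < 0) :
    (∫ x, cutoff R x * ‖u t₁ x‖ ^ 2) - (∫ x, cutoff R x * ‖u t₀ x‖ ^ 2) =
      ∫ s in t₀..t₁, ∫ x, (fderiv ℝ (cutoff R) x (u s x) * ‖u s x‖ ^ 2 +
        2 * (p s x * fderiv ℝ (cutoff R) x (u s x))) := by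
  have hI : Icc t₀ t₁ ⊆ Iio (0 : ℝ) := fun s hs => lt_of_le_of_lt hs.2 ht₁
  have h := hns.local_energy_identity_cutoff isOpen_Iio (contDiff_cutoff R) (hasCompactSupport_cutoff hR)
    h01 hI
  simp only [zero_mul, mul_zero, zero_add, add_zero] at h
  exact h

/-! ## The gradient of the cut-off lives on the shell `R ≤ |y| ≤ 2R` -/

/-- The Euler flux density against `χ_R` vanishes off the closed shell `R ≤ |y| ≤ 2R`. [folklore] -/
theorem flux_integrand_eq_zero_of_not_mem_shell {R : ℝ} (hR : 0 < R) (τ : ℝ)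
    {x : EuclideanSpace ℝ (Fin 3)} (hx : x ∉ {y : EuclideanSpace ℝ (Fin 3) | R ≤ ‖y‖ ∧ ‖y‖ ≤ 2 * R}) :
    fderiv ℝ (cutoff R) x (u τ x) * ‖u τ x‖ ^ 2 + 2 * (p τ x * fderiv ℝ (cutoff R) x (u τ x)) = 0 := by
  simp only [mem_setOf_eq, not_and_or, not_le] at hx
  rcases hx with h | h
  · simp [fderiv_cutoff_eq_zero_of_lt hR h]
  · simp [fderiv_cutoff_eq_zero_of_gt hR h]

/-! ## The flux bound -/

/-- **Flux bound through the shell.** If `‖Dχ_R‖ ≤ C/R` everywhere and `u(τ)`, `p(τ)` are continuous, then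
`|∫ (Dχ_R(u)|u|² + 2 p Dχ_R(u))| ≤ (C/R) · ∫_{R ≤ |y| ≤ 2R} (|u|³ + 2|p||u|)`. [folklore] -/
theorem abs_flux_le_shell {R C : ℝ} (hR : 0 < R) (hC : ∀ x : EuclideanSpace ℝ (Fin 3), ‖fderiv ℝ (cutoff R) x‖ ≤ C / R)
    {τ : ℝ} (hu : Continuous (u τ)) (hp : Continuous (p τ)) :
    |∫ x, (fderiv ℝ (cutoff R) x (u τ x) * ‖u τ x‖ ^ 2 + 2 * (p τ x * fderiv ℝ (cutoff R) x (u τ x)))| ≤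
      C / R * ∫ x in {y : EuclideanSpace ℝ (Fin 3) | R ≤ ‖y‖ ∧ ‖y‖ ≤ 2 * R},
        (‖u τ x‖ ^ 3 + 2 * |p τ x| * ‖u τ x‖) := by
  set S : Set (EuclideanSpace ℝ (Fin 3)) := {y | R ≤ ‖y‖ ∧ ‖y‖ ≤ 2 * R} with hS
  have hCR : 0 ≤ C / R := by
    have h0 := hC 0
    exact le_trans (norm_nonneg _) h0
  -- restrict the flux integral to the shell
  have hrestr : ∫ x, (fderiv ℝ (cutoff R) x (u τ x) * ‖u τ x‖ ^ 2 + 2 * (p τ x * fderiv ℝ (cutoff R) x (u τ x))) =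
      ∫ x in S, (fderiv ℝ (cutoff R) x (u τ x) * ‖u τ x‖ ^ 2 + 2 * (p τ x * fderiv ℝ (cutoff R) x (u τ x))) :=
    (setIntegral_eq_integral_of_forall_compl_eq_zero fun x hx =>
      flux_integrand_eq_zero_of_not_mem_shell hR τ hx).symm
  rw [hrestr]
  -- the dominating function is integrable on the compact shell
  have hg : Continuous fun x => ‖u τ x‖ ^ 3 + 2 * |p τ x| * ‖u τ x‖ := by
    have h1 : Continuous fun x => ‖u τ x‖ := hu.norm
    have h2 : Continuous fun x => |p τ x| := hp.abs
    exact (h1.pow 3).add ((continuous_const.mul h2).mul h1)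
  have hgi : IntegrableOn (fun x => C / R * (‖u τ x‖ ^ 3 + 2 * |p τ x| * ‖u τ x‖)) S volume :=
    ((continuous_const.mul hg).continuousOn).integrableOn_compact (Calculus.isCompact_shell_closed R (2 * R))
  have hbound : ∀ᵐ x ∂(volume.restrict S),
      ‖fderiv ℝ (cutoff R) x (u τ x) * ‖u τ x‖ ^ 2 + 2 * (p τ x * fderiv ℝ (cutoff R) x (u τ x))‖ ≤
        C / R * (‖u τ x‖ ^ 3 + 2 * |p τ x| * ‖u τ x‖) := by
    refine Eventually.of_forall fun x => ?_
    have hD : |fderiv ℝ (cutoff R) x (u τ x)| ≤ C / R * ‖u τ x‖ := by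
      rw [← Real.norm_eq_abs]
      exact (ContinuousLinearMap.le_opNorm _ _).trans (mul_le_mul_of_nonneg_right (hC x) (norm_nonneg _))
    have hu0 : 0 ≤ ‖u τ x‖ := norm_nonneg _
    have h1 : |fderiv ℝ (cutoff R) x (u τ x) * ‖u τ x‖ ^ 2| ≤ C / R * ‖u τ x‖ ^ 3 := by
      rw [abs_mul, abs_of_nonneg (sq_nonneg ‖u τ x‖)]
      calc |fderiv ℝ (cutoff R) x (u τ x)| * ‖u τ x‖ ^ 2 ≤ C / R * ‖u τ x‖ * ‖u τ x‖ ^ 2 :=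
            mul_le_mul_of_nonneg_right hD (sq_nonneg _)
        _ = C / R * ‖u τ x‖ ^ 3 := by ring
    have h2 : |2 * (p τ x * fderiv ℝ (cutoff R) x (u τ x))| ≤ C / R * (2 * |p τ x| * ‖u τ x‖) := by
      rw [abs_mul, abs_mul, abs_of_pos (by norm_num : (0 : ℝ) < 2)]
      calc 2 * (|p τ x| * |fderiv ℝ (cutoff R) x (u τ x)|) ≤ 2 * (|p τ x| * (C / R * ‖u τ x‖)) := by
            gcongr
        _ = C / R * (2 * |p τ x| * ‖u τ x‖) := by ring
    rw [Real.norm_eq_abs]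
    calc |fderiv ℝ (cutoff R) x (u τ x) * ‖u τ x‖ ^ 2 + 2 * (p τ x * fderiv ℝ (cutoff R) x (u τ x))|
        ≤ |fderiv ℝ (cutoff R) x (u τ x) * ‖u τ x‖ ^ 2| + |2 * (p τ x * fderiv ℝ (cutoff R) x (u τ x))| :=
          abs_add_le _ _
      _ ≤ C / R * ‖u τ x‖ ^ 3 + C / R * (2 * |p τ x| * ‖u τ x‖) := add_le_add h1 h2
      _ = C / R * (‖u τ x‖ ^ 3 + 2 * |p τ x| * ‖u τ x‖) := by ring
  have key := norm_integral_le_of_norm_le hgi hbound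
  rw [Real.norm_eq_abs] at key
  refine key.trans (le_of_eq ?_)
  exact integral_const_mul _ _

/-! ## Two-time estimate -/

/-- **Cut-off energies hardly move when the shell flux is small.** For `(u,p)` classical on the open slab,
`R > 0` with `‖Dχ_R‖ ≤ C/R`, and `τ₁ ≤ τ₂ < 0` such that `∫_{R≤|y|≤2R}(|u(τ)|³ + 2|p(τ)||u(τ)|) ≤ M` for all
`τ ∈ [τ₁, τ₂]`: `|∫ χ_R|u(τ₂)|² − ∫ χ_R|u(τ₁)|²| ≤ (C/R) · M · (τ₂ − τ₁)`. [folklore] -/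
theorem abs_cutoffEnergy_sub_le (hns : IsClassicalNSSolutionOn (Iio 0) 0 0 u p) {R C : ℝ} (hR : 0 < R)
    (hC : ∀ x : EuclideanSpace ℝ (Fin 3), ‖fderiv ℝ (cutoff R) x‖ ≤ C / R) {τ₁ τ₂ M : ℝ} (h12 : τ₁ ≤ τ₂)
    (hτ₂ : τ₂ < 0)
    (hM : ∀ τ ∈ Icc τ₁ τ₂, ∫ x in {y : EuclideanSpace ℝ (Fin 3) | R ≤ ‖y‖ ∧ ‖y‖ ≤ 2 * R},
      (‖u τ x‖ ^ 3 + 2 * |p τ x| * ‖u τ x‖) ≤ M) :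
    |(∫ x, cutoff R x * ‖u τ₂ x‖ ^ 2) - (∫ x, cutoff R x * ‖u τ₁ x‖ ^ 2)| ≤ C / R * M * (τ₂ - τ₁) := by
  have hCR : 0 ≤ C / R := le_trans (norm_nonneg _) (hC 0)
  rw [cutoffEnergy_sub_eq hns hR h12 hτ₂]
  have hb : ∀ s ∈ Ι τ₁ τ₂, ‖∫ x, (fderiv ℝ (cutoff R) x (u s x) * ‖u s x‖ ^ 2 +
      2 * (p s x * fderiv ℝ (cutoff R) x (u s x)))‖ ≤ C / R * M := by
    intro s hs
    rw [uIoc_of_le h12] at hs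
    have hs' : s ∈ Icc τ₁ τ₂ := ⟨hs.1.le, hs.2⟩
    have hs0 : s ∈ Iio (0 : ℝ) := lt_of_le_of_lt hs.2 hτ₂
    have hu : Continuous (u s) := (hns.contDiff_velocity hs0).continuous
    have hp : Continuous (p s) := (hns.contDiff_pressure hs0).continuous
    rw [Real.norm_eq_abs]
    exact (abs_flux_le_shell hR hC hu hp).trans (mul_le_mul_of_nonneg_left (hM s hs') hCR)
  have key := intervalIntegral.norm_integral_le_of_norm_le_const hb
  rw [Real.norm_eq_abs, abs_of_nonneg (sub_nonneg.2 h12)] at key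
  linarith [key]


/-! ## Near the collapse time the cut-off energies freeze -/

/-- Under the shell hypothesis `∫_{R≤|y|≤2R}(|u(τ)|³+2|p(τ)||u(τ)|) ≤ K R^β` for `R ≥ R₀(−τ)^γ` (`R₀, γ ≥ 0`):
for `R ≥ R₀(−τ₁)^γ` and `τ₁ ≤ τ₂ < 0`, `|e_R(τ₂) − e_R(τ₁)| ≤ (C/R)·(K R^β)·(τ₂ − τ₁)`. [folklore] -/
theorem abs_cutoffEnergy_sub_le_of_shell (hns : IsClassicalNSSolutionOn (Iio 0) 0 0 u p) {R C K R₀ γ β : ℝ}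
    (hR : 0 < R) (hC : ∀ x : EuclideanSpace ℝ (Fin 3), ‖fderiv ℝ (cutoff R) x‖ ≤ C / R) (hR₀ : 0 ≤ R₀)
    (hγ : 0 ≤ γ)
    (hshell : ∀ τ : ℝ, τ < 0 → ∀ R : ℝ, 0 < R → R₀ * (-τ) ^ γ ≤ R →
      ∫ x in {y : EuclideanSpace ℝ (Fin 3) | R ≤ ‖y‖ ∧ ‖y‖ ≤ 2 * R},
        (‖u τ x‖ ^ 3 + 2 * |p τ x| * ‖u τ x‖) ≤ K * R ^ β)
    {τ₁ τ₂ : ℝ} (h12 : τ₁ ≤ τ₂) (hτ₂ : τ₂ < 0) (hRτ : R₀ * (-τ₁) ^ γ ≤ R) :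
    |(∫ x, cutoff R x * ‖u τ₂ x‖ ^ 2) - (∫ x, cutoff R x * ‖u τ₁ x‖ ^ 2)| ≤
      C / R * (K * R ^ β) * (τ₂ - τ₁) := by
  refine abs_cutoffEnergy_sub_le hns hR hC h12 hτ₂ fun τ hτ => hshell τ (lt_of_le_of_lt hτ.2 hτ₂) R hR ?_
  have hmono : (-τ) ^ γ ≤ (-τ₁) ^ γ :=
    Real.rpow_le_rpow (by linarith [hτ.2]) (by linarith [hτ.1]) hγ
  exact (mul_le_mul_of_nonneg_left hmono hR₀).trans hRτ

/-- **The collapse-time energy profile exists.** Under the shell hypothesis, for `R ≥ R₀(−τ₀)^γ` (`τ₀ < 0`) the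
cut-off energy `e_R(τ) = ∫ χ_R|u(τ)|²` has a limit `L(R)` as `τ → 0⁻`, and `|e_R(τ) − L(R)| ≤ (C/R) K R^β (−τ)`
for `τ ∈ [τ₀, 0)` (the map `τ ↦ e_R(τ) + mτ`, `m = (C/R)KR^β`, is nondecreasing and bounded).  `L(R)` is the
blow-up-time energy measure `𝓔₀` of Shvydkoy 2013 / Bronzi–Shvydkoy 2015 Rem. 1.2 tested against `χ_R`.
[folklore; cf. BronziShvydkoy2015 Rem. 1.2] -/
theorem exists_tendsto_cutoffEnergy (hns : IsClassicalNSSolutionOn (Iio 0) 0 0 u p) {R C K R₀ γ β : ℝ}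
    (hR : 0 < R) (hC0 : 0 ≤ C) (hC : ∀ x : EuclideanSpace ℝ (Fin 3), ‖fderiv ℝ (cutoff R) x‖ ≤ C / R)
    (hK : 0 ≤ K) (hR₀ : 0 ≤ R₀) (hγ : 0 ≤ γ)
    (hshell : ∀ τ : ℝ, τ < 0 → ∀ R : ℝ, 0 < R → R₀ * (-τ) ^ γ ≤ R →
      ∫ x in {y : EuclideanSpace ℝ (Fin 3) | R ≤ ‖y‖ ∧ ‖y‖ ≤ 2 * R},
        (‖u τ x‖ ^ 3 + 2 * |p τ x| * ‖u τ x‖) ≤ K * R ^ β)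
    {τ₀ : ℝ} (hτ₀ : τ₀ < 0) (hRτ : R₀ * (-τ₀) ^ γ ≤ R) :
    ∃ L : ℝ, Tendsto (fun τ => ∫ x, cutoff R x * ‖u τ x‖ ^ 2) (𝓝[<] 0) (𝓝 L) ∧
      ∀ τ ∈ Ico τ₀ 0, |(∫ x, cutoff R x * ‖u τ x‖ ^ 2) - L| ≤ C / R * (K * R ^ β) * (-τ) := by
  set m : ℝ := C / R * (K * R ^ β) with hm
  have hm0 : 0 ≤ m := by positivity
  set e : ℝ → ℝ := fun τ => ∫ x, cutoff R x * ‖u τ x‖ ^ 2 with he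
  -- two-time bound from any `a ∈ [τ₀, 0)`
  have hab : ∀ a b : ℝ, τ₀ ≤ a → a ≤ b → b < 0 → |e b - e a| ≤ m * (b - a) := by
    intro a b ha hab hb
    have hRa : R₀ * (-a) ^ γ ≤ R := by
      have : (-a) ^ γ ≤ (-τ₀) ^ γ := Real.rpow_le_rpow (by linarith) (by linarith) hγ
      exact (mul_le_mul_of_nonneg_left this hR₀).trans hRτ
    exact abs_cutoffEnergy_sub_le_of_shell hns hR hC hR₀ hγ hshell hab hb hRa
  -- `f τ = e τ + m τ` is nondecreasing on `(τ₀, 0)` and bounded above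
  set f : ℝ → ℝ := fun τ => e τ + m * τ with hf
  have hmono : MonotoneOn f (Ioo τ₀ 0) := by
    intro a ha b hb hab'
    have h := hab a b ha.1.le hab' hb.2
    have h' : -(m * (b - a)) ≤ e b - e a := by
      have := neg_abs_le (e b - e a)
      linarith
    show e a + m * a ≤ e b + m * b
    nlinarith
  have hbdd : BddAbove (f '' Ioo τ₀ 0) := by
    refine ⟨e τ₀ + m * (-τ₀), ?_⟩
    rintro _ ⟨τ, hτ, rfl⟩
    have h := hab τ₀ τ le_rfl hτ.1.le hτ.2
    have h' : e τ - e τ₀ ≤ m * (τ - τ₀) := (le_abs_self _).trans h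
    show e τ + m * τ ≤ e τ₀ + m * (-τ₀)
    nlinarith [hτ.1, hτ.2]
  have hne : (Ioo τ₀ (0 : ℝ)).Nonempty := ⟨τ₀ / 2, by constructor <;> linarith⟩
  have hflim := hmono.tendsto_nhdsWithin_Ioo_left hne hbdd
  set S := sSup (f '' Ioo τ₀ 0) with hS
  -- hence `e τ = f τ - m τ → S`
  have hlin : Tendsto (fun τ : ℝ => m * τ) (𝓝[<] (0 : ℝ)) (𝓝 0) := by
    have : Tendsto (fun τ : ℝ => m * τ) (𝓝 (0 : ℝ)) (𝓝 (m * 0)) :=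
      (continuous_const.mul continuous_id).tendsto 0
    rw [mul_zero] at this
    exact this.mono_left nhdsWithin_le_nhds
  have helim : Tendsto e (𝓝[<] 0) (𝓝 S) := by
    have h := hflim.sub hlin
    rw [sub_zero] at h
    refine h.congr' (Eventually.of_forall fun τ => ?_)
    simp [hf]
  refine ⟨S, helim, fun τ hτ => ?_⟩
  -- the rate: pass to the limit in `|e τ' - e τ| ≤ m (τ' - τ) ≤ m (-τ)`
  have hev : ∀ᶠ τ' in 𝓝[<] (0 : ℝ), |e τ' - e τ| ≤ m * (-τ) := by
    filter_upwards [Ioo_mem_nhdsLT hτ.2] with τ' hτ'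
    exact (hab τ τ' hτ.1 hτ'.1.le hτ'.2).trans (by nlinarith [hτ'.2])
  have hlim' : Tendsto (fun τ' => |e τ' - e τ|) (𝓝[<] 0) (𝓝 |S - e τ|) :=
    (helim.sub_const (e τ)).abs
  have := le_of_tendsto hlim' hev
  rwa [abs_sub_comm] at this

/-! ## The triviality criterion -/

/-- The ball energy is dominated by the cut-off energy: `∫_{B_r}|u(τ)|² ≤ ∫ χ_R |u(τ)|²` for `r ≤ R`.
[folklore] -/
theorem setIntegral_ball_le_cutoffEnergy {τ r R : ℝ} (hR : 0 < R) (hrR : r ≤ R) (hu : Continuous (u τ)) :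
    ∫ x in ball (0 : EuclideanSpace ℝ (Fin 3)) r, ‖u τ x‖ ^ 2 ≤ ∫ x, cutoff R x * ‖u τ x‖ ^ 2 := by
  have hg : Continuous fun x => ‖u τ x‖ ^ 2 := (hu.norm).pow 2
  rw [← integral_indicator measurableSet_ball]
  refine integral_mono ?_ ?_ fun x => ?_
  · exact ((hg.continuousOn.integrableOn_compact (isCompact_closedBall (0 : EuclideanSpace ℝ (Fin 3)) r)).mono_set
      ball_subset_closedBall).integrable_indicator measurableSet_ball
  · refine ((contDiff_cutoff (n := 0) R).continuous.mul hg).integrable_of_hasCompactSupport ?_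
    exact (hasCompactSupport_cutoff hR).mul_right
  · by_cases hx : x ∈ ball (0 : EuclideanSpace ℝ (Fin 3)) r
    · rw [indicator_of_mem hx]
      have hxR : ‖x‖ ≤ R := (le_of_lt (mem_ball_zero_iff.1 hx)).trans hrR
      rw [cutoff_eq_one hR hxR, one_mul]
    · rw [indicator_of_notMem hx]
      exact mul_nonneg (cutoff_nonneg R x) (sq_nonneg _)

/-- **TRIVIALITY CRITERION at the collapse time.** Let `(u, p)` be a classical Euler flow on the open slab
`(−∞,0) × ℝ³` satisfying the shell hypothesis `∫_{R≤|y|≤2R}(|u(τ)|³ + 2|p(τ)||u(τ)|) ≤ K R^β` for all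
`R ≥ R₀(−τ)^γ` (`R₀, γ ≥ 0`, `β < 1`).  If for arbitrarily large `R` the cut-off energy `∫ χ_R|u(τ)|²` takes
values `≤ ε` at times arbitrarily close to `0⁻`, for every `ε > 0` (i.e. `liminf_{τ→0⁻} ∫χ_R|u(τ)|² = 0` along
an unbounded set of radii), then `u ≡ 0` on the slab.  Mechanism: `e_R(τ₁) ≤ e_R(τ) + (C/R)KR^β(−τ₁)` for
`τ ∈ (τ₁,0)`, so `∫_{B_r}|u(τ₁)|² ≤ e_R(τ₁) ≤ C K R^{β−1}(−τ₁) → 0` as `R → ∞`.  [folklore] -/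
theorem eq_zero_of_collapseEnergy_vanishing (hns : IsClassicalNSSolutionOn (Iio 0) 0 0 u p) {K R₀ γ β : ℝ}
    (hK : 0 ≤ K) (hR₀ : 0 ≤ R₀) (hγ : 0 ≤ γ) (hβ : β < 1)
    (hshell : ∀ τ : ℝ, τ < 0 → ∀ R : ℝ, 0 < R → R₀ * (-τ) ^ γ ≤ R →
      ∫ x in {y : EuclideanSpace ℝ (Fin 3) | R ≤ ‖y‖ ∧ ‖y‖ ≤ 2 * R},
        (‖u τ x‖ ^ 3 + 2 * |p τ x| * ‖u τ x‖) ≤ K * R ^ β)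
    (hvan : ∀ Rbar : ℝ, ∃ R : ℝ, Rbar ≤ R ∧ ∀ ε : ℝ, 0 < ε → ∀ τ₁ : ℝ, τ₁ < 0 →
      ∃ τ : ℝ, τ₁ ≤ τ ∧ τ < 0 ∧ ∫ x, cutoff R x * ‖u τ x‖ ^ 2 ≤ ε) :
    ∀ τ : ℝ, τ < 0 → ∀ y : EuclideanSpace ℝ (Fin 3), u τ y = 0 := by
  obtain ⟨C, hC0, hC⟩ := exists_norm_fderiv_cutoff_le (E := EuclideanSpace ℝ (Fin 3))
  intro τ₁ hτ₁
  by_contra hcon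
  push Not at hcon
  obtain ⟨y, hy⟩ := hcon
  have hu : Continuous (u τ₁) := (hns.contDiff_velocity hτ₁).continuous
  set g : EuclideanSpace ℝ (Fin 3) → ℝ := fun x => ‖u τ₁ x‖ ^ 2 with hg
  have hgc : Continuous g := (hu.norm).pow 2
  set r : ℝ := ‖y‖ + 1 with hr
  -- the ball energy `I₀ = ∫_{B_r} |u(τ₁)|²` is positive
  have hgi : IntegrableOn g (ball (0 : EuclideanSpace ℝ (Fin 3)) r) volume :=
    (hgc.continuousOn.integrableOn_compact (isCompact_closedBall (0 : EuclideanSpace ℝ (Fin 3)) r)).mono_set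
      ball_subset_closedBall
  have hI0 : 0 < ∫ x in ball (0 : EuclideanSpace ℝ (Fin 3)) r, g x := by
    rw [setIntegral_pos_iff_support_of_nonneg_ae (Eventually.of_forall fun x => sq_nonneg _) hgi]
    have hopen : IsOpen (support g ∩ ball (0 : EuclideanSpace ℝ (Fin 3)) r) := by
      refine IsOpen.inter ?_ isOpen_ball
      rw [support_eq_preimage]
      exact isOpen_compl_singleton.preimage hgc
    refine hopen.measure_pos volume ⟨y, ?_, ?_⟩
    · rw [mem_support, hg]
      exact pow_ne_zero 2 (norm_ne_zero_iff.2 hy)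
    · rw [mem_ball_zero_iff, hr]
      linarith
  set I₀ : ℝ := ∫ x in ball (0 : EuclideanSpace ℝ (Fin 3)) r, g x with hI
  -- choose the radius: large, admissible, and with `C K R^{β-1} (-τ₁) < I₀`
  have hdecay : Tendsto (fun R : ℝ => C * K * (-τ₁) * R ^ (-(1 - β))) atTop (𝓝 0) := by
    have h := (tendsto_rpow_neg_atTop (by linarith : 0 < 1 - β)).const_mul (C * K * (-τ₁))
    rwa [mul_zero] at h
  have hev : ∀ᶠ R : ℝ in atTop, C * K * (-τ₁) * R ^ (-(1 - β)) < I₀ ∧ r ≤ R ∧ R₀ * (-τ₁) ^ γ ≤ R ∧ 1 ≤ R :=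
    (hdecay.eventually_lt_const hI0).and ((eventually_ge_atTop r).and
      ((eventually_ge_atTop _).and (eventually_ge_atTop 1)))
  obtain ⟨Rbar, hRbar⟩ := Filter.eventually_atTop.1 hev
  obtain ⟨R, hRR, hR⟩ := hvan Rbar
  obtain ⟨hlt, hrR, hR₀R, h1R⟩ := hRbar R hRR
  have hRpos : 0 < R := lt_of_lt_of_le one_pos h1R
  -- `I₀ ≤ e_R(τ₁) ≤ ε + C K R^{β-1} (-τ₁)` for every `ε > 0`
  have hkey : I₀ ≤ C * K * (-τ₁) * R ^ (-(1 - β)) := by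
    refine le_of_forall_pos_le_add fun ε hε => ?_
    obtain ⟨τ, hτ₁τ, hτ0, hετ⟩ := hR ε hε τ₁ hτ₁
    have hdiff := abs_cutoffEnergy_sub_le_of_shell hns hRpos (hC R hRpos) hR₀ hγ hshell hτ₁τ hτ0 hR₀R
    have h1 : (∫ x, cutoff R x * ‖u τ₁ x‖ ^ 2) ≤ (∫ x, cutoff R x * ‖u τ x‖ ^ 2) +
        C / R * (K * R ^ β) * (τ - τ₁) := by
      have := neg_abs_le ((∫ x, cutoff R x * ‖u τ x‖ ^ 2) - ∫ x, cutoff R x * ‖u τ₁ x‖ ^ 2)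
      linarith
    have h2 : C / R * (K * R ^ β) * (τ - τ₁) ≤ C * K * (-τ₁) * R ^ (-(1 - β)) := by
      have hpow : C / R * (K * R ^ β) = C * K * R ^ (-(1 - β)) := by
        rw [show -(1 - β) = β - 1 by ring, Real.rpow_sub hRpos, Real.rpow_one]
        field_simp
      have hfac : 0 ≤ C * K * R ^ (-(1 - β)) := by positivity
      calc C / R * (K * R ^ β) * (τ - τ₁) = C * K * R ^ (-(1 - β)) * (τ - τ₁) := by rw [hpow]
        _ ≤ C * K * R ^ (-(1 - β)) * (-τ₁) := mul_le_mul_of_nonneg_left (by linarith) hfac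
        _ = C * K * (-τ₁) * R ^ (-(1 - β)) := by ring
    have h3 : I₀ ≤ ∫ x, cutoff R x * ‖u τ₁ x‖ ^ 2 := setIntegral_ball_le_cutoffEnergy hRpos hrR hu
    linarith
  exact absurd hkey (not_le.2 hlt)

/-- The slab statement: under the hypotheses of `eq_zero_of_collapseEnergy_vanishing`, `u = 0` a.e. on
`(−∞,0) × ℝ³` (the conclusion shape of the crux). [folklore] -/
theorem ae_eq_zero_of_collapseEnergy_vanishing (hns : IsClassicalNSSolutionOn (Iio 0) 0 0 u p) {K R₀ γ β : ℝ}
    (hK : 0 ≤ K) (hR₀ : 0 ≤ R₀) (hγ : 0 ≤ γ) (hβ : β < 1)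
    (hshell : ∀ τ : ℝ, τ < 0 → ∀ R : ℝ, 0 < R → R₀ * (-τ) ^ γ ≤ R →
      ∫ x in {y : EuclideanSpace ℝ (Fin 3) | R ≤ ‖y‖ ∧ ‖y‖ ≤ 2 * R},
        (‖u τ x‖ ^ 3 + 2 * |p τ x| * ‖u τ x‖) ≤ K * R ^ β)
    (hvan : ∀ Rbar : ℝ, ∃ R : ℝ, Rbar ≤ R ∧ ∀ ε : ℝ, 0 < ε → ∀ τ₁ : ℝ, τ₁ < 0 →
      ∃ τ : ℝ, τ₁ ≤ τ ∧ τ < 0 ∧ ∫ x, cutoff R x * ‖u τ x‖ ^ 2 ≤ ε) :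
    uncurry u =ᵐ[volume.restrict (Iio (0 : ℝ) ×ˢ (univ : Set (EuclideanSpace ℝ (Fin 3))))] 0 := by
  have h := eq_zero_of_collapseEnergy_vanishing hns hK hR₀ hγ hβ hshell hvan
  refine (ae_restrict_iff' (measurableSet_Iio.prod MeasurableSet.univ)).2 (Eventually.of_forall ?_)
  rintro ⟨τ, y⟩ ⟨hτ, -⟩
  exact h τ hτ y

end Summit.NavierStokesRegularity.NavierStokesRegularity.Theorems.PowerGaugeEulerLiouville.CollapseEnergy

end
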